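import Literature.MathematicalPhysics.QuantumFieldTheory.King1986.PropagatorDecayUniform

/-!
# King 1986 ∕ [Ba 4] (1.10), CLAUSE 2 (the derivative), IN KING'S SPELLING AND SUP-NORM OPERATOR FORM, mass-uniform:
# `|N·((A₀⁻¹f)(x + e_μ) − (A₀⁻¹f)(x))| ≤ c₀·e^{−δ₀·dist}·‖f‖_∞` for EVERY volume, EVERY number of levels, EVERY mass under the cap

TEMPLATE LITERATURE, `A = 0`.  [Balaban1983RegularityDecay] Theorem (1.10) p. 573 prints, for the propagator `G_k(Ω, A) = (−Δ_A +
m² + a_kP_k(A))⁻¹` of (1.6) and a function `f`, the two estimates `|(G_k(Ω, A)f)(x)|, |(D^η_{A,μ}G_k(Ω, A)f)(x)| ≤ c₀exp(−δ₀dist(x,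
supp f))‖f‖` with `δ₀, c₀` depending on `d`, `L` (and the mass cap) only; C. King's Theorem 3.3 (3.7) p. 658 quotes it for his scalar
model WITH THE DERIVATIVE («|(G_k(A)f)(x)|, |(∇^ε_A G_k(A)f)(x)| ≤ Cexp[−δ₀dist(x, supp f)]‖f‖»).  The tree's kernel-checked A = 0 torus
edition is `B4Thm110ZeroTorus(Uniform).thm110_zero_torus(_unif)` (clause 1 = value, clause 2 = forward ε-derivative `deriv P 0 ε μ * G`),
stated on the TOWER labels `Site P 0`.  `PropagatorDecayUniform` §5 (v1.2) transported CLAUSE 1 to King's spelling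
`(fineOp N M a_K N² m²)⁻¹ *ᵥ f` on `Tor (fine N M)` (`fineOp_inv_mulVec_le_unif`, `fineOp_inv_mulVec_decay_unif`); its §4 (v1.1) transported
clause 2 for a POINT source only (`fineOp_inv_deriv_decay_unif`, honest factor `N^d` downstream).

THIS FILE = CLAUSE 2 IN OPERATOR FORM, King's spelling, no point-source price:
* `fineOp_inv_mulVec_toTor` — the bridge for a general source: `((A₀⁻¹ f)(toTor x) = (G_K (f ∘ toTor))(x)` (`fineOp_inv_toTor_toTor` entry by
  entry + `torEquiv.sum_comp`);
* `fineOp_inv_deriv_mulVec_toTor` — `N·((A₀⁻¹f)(toTor x + e_μ) − (A₀⁻¹f)(toTor x)) = ((∂^ε_μ G_K)(f ∘ toTor))(x)` (`toTor_shift`, B1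
  `deriv_mulVec`, `ε⁻¹ = N`);
* **`fineOp_inv_deriv_mulVec_le_unif`** — `∃ c₀ > 0 ∀ 0 ≤ m² ≤ m₀² ∀ volumes (K ≥ 1) ∀ N = L^K ∀ f, |f| ≤ F ∀ x μ:
  |N·(((fineOp N M a_K N² m²)⁻¹ f)(x + e_μ) − ((fineOp N M a_K N² m²)⁻¹ f)(x))| ≤ c₀·F`;
* **`fineOp_inv_deriv_mulVec_decay_unif`** — the same `× e^{−δ₀D}` for sources vanishing on the fine points whose unit block is within torus
  distance `< D` of the block of `x` (block currency; the slack `e^{2δ₀}` of `T_blk_le_eps_mul` is in `c₀`).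
Proofs = `PropagatorDecayUniform` §5 verbatim with clause `.2 μ` of `thm110_zero_torus_unif` and the derivative bridge.

WHY (cell `pub-ymgap`, node N15 = NE2, King-model rung PART Q): the Summits-side operator-form η-rate of the GRADIENT of King's full `A = 0`
fluctuation propagator ([B9] (3.42) entry `|∇_U G λ|` at `U ≡ 1`) uses it for the fine run at the bottom of its induction on the number of levels.

HONEST SCOPE.  (i) `A = 0`, periodic b.c., Bałaban's volumes `M_μ = 2L^m` (`sitesPerDir`), odd `L > 1`, `0 ≤ m² ≤ m₀²`; (ii) forward
derivative in the OBSERVATION point only (what (1.10) prints); no `G∇*` clause, no Hölder clause; (iii) block-distance currency in the decay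
form.  HONEST FRAMING: King's `A = 0` scalar MODEL on finite tori; template literature; nothing about Bałaban's covariant `G_k(U)`; nothing
continuum ∕ ℝ⁴ ∕ OS ∕ mass-gap ∕ Clay; count-neutral.
Locators: [Balaban1983RegularityDecay] T. Bałaban, CMP **89** (1983) 571–597, Theorem (1.10) p. 573, (1.6) p. 572; [King1986] C. King, CMP **102**
(1986) 649–677, Theorem 3.3 (3.7) p. 658, (2.13) p. 653, (4.1)–(4.5) p. 670.
-/

noncomputable section

open Finset Real Matrix
open scoped BigOperators

namespace Literature.MathematicalPhysics.QuantumFieldTheory.King1986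

open Literature.MathematicalPhysics.QuantumFieldTheory.Balaban1983to89 (Params)
open Literature.MathematicalPhysics.QuantumFieldTheory.Balaban1983to89.B5Prop11Plancherel
open Literature.MathematicalPhysics.QuantumFieldTheory.Balaban1983to89.B1RG242Torus (tower deriv deriv_mulVec)
open Literature.MathematicalPhysics.QuantumFieldTheory.Balaban1983to89.B5Ineq137Torus (T blk)

namespace Torus

variable {d : ℕ}

/-! ## §1 The bridges for a general source -/

/-- **The operator bridge for a general source**: `((A₀⁻¹ f)(toTor x) = (G_K (f ∘ toTor))(x)` — `fineOp_inv_toTor_toTor` entry by entry and the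
re-indexing of the fine sum along `torEquiv`. [cite: Balaban1983RegularityDecay, (1.6) p.572; King1986, (2.13) p.653, (4.1)–(4.5) p.670] -/
theorem fineOp_inv_mulVec_toTor (P : Params) (M : Fin P.d → ℕ) [∀ μ, NeZero (M μ)]
    (hMK : ∀ μ, M μ = P.sitesPerDir P.K) (a msq : ℝ) (f : Tor (fine (P.L ^ P.K) M) → ℝ) (x : Balaban1983to89.Site P 0) :
    ((fineOp (P.L ^ P.K) M (aK a P.L P.K) ((((P.L ^ P.K : ℕ) : ℝ)) ^ 2) msq)⁻¹ *ᵥ f) (toTor P M hMK x)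
      = ((tower P a msq).G P.K *ᵥ (fun z => f (toTor P M hMK z))) x := by
  rw [Matrix.mulVec, Matrix.mulVec, dotProduct, dotProduct,
    ← (torEquiv P M hMK).sum_comp (fun yt => (fineOp (P.L ^ P.K) M (aK a P.L P.K)
      ((((P.L ^ P.K : ℕ) : ℝ)) ^ 2) msq)⁻¹ (toTor P M hMK x) yt * f yt)]
  refine Finset.sum_congr rfl fun y _ => ?_
  show (fineOp (P.L ^ P.K) M (aK a P.L P.K) ((((P.L ^ P.K : ℕ) : ℝ)) ^ 2) msq)⁻¹ (toTor P M hMK x) (toTor P M hMK y)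
      * f (toTor P M hMK y) = (tower P a msq).G P.K x y * f (toTor P M hMK y)
  rw [← aSeq_eq_aK, ← eps_inv_sq, fineOp_inv_toTor_toTor P M hMK]

/-- **The derivative bridge for a general source**: `N·((A₀⁻¹f)(toTor x + e_μ) − (A₀⁻¹f)(toTor x)) = ((∂^ε_μ G_K)(f ∘ toTor))(x)` (`N = L^K =
ε⁻¹`; `toTor_shift`: a lattice step of `T_ε` is a lattice step of `Tor (fine L^K M)`; B1 `deriv_mulVec`).
[cite: Balaban1983RegularityDecay, (1.6) p.572, Theorem (1.10) p.573; King1986, Theorem 3.3 (3.7) p.658] -/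
theorem fineOp_inv_deriv_mulVec_toTor (P : Params) (M : Fin P.d → ℕ) [∀ μ, NeZero (M μ)]
    (hMK : ∀ μ, M μ = P.sitesPerDir P.K) (a msq : ℝ) (f : Tor (fine (P.L ^ P.K) M) → ℝ) (x : Balaban1983to89.Site P 0)
    (μ : Fin P.d) :
    (((P.L ^ P.K : ℕ) : ℝ)) *
        (((fineOp (P.L ^ P.K) M (aK a P.L P.K) ((((P.L ^ P.K : ℕ) : ℝ)) ^ 2) msq)⁻¹ *ᵥ f)
            (toTor P M hMK x + unitVec (fine (P.L ^ P.K) M) μ)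
          - ((fineOp (P.L ^ P.K) M (aK a P.L P.K) ((((P.L ^ P.K : ℕ) : ℝ)) ^ 2) msq)⁻¹ *ᵥ f) (toTor P M hMK x))
      = ((deriv P 0 P.eps μ * (tower P a msq).G P.K) *ᵥ (fun z => f (toTor P M hMK z))) x := by
  have hepsN : P.eps⁻¹ = ((P.L ^ P.K : ℕ) : ℝ) := by
    rw [Params.eps, inv_pow, inv_inv]; push_cast; rfl
  rw [← toTor_shift P M hMK x μ, fineOp_inv_mulVec_toTor P M hMK, fineOp_inv_mulVec_toTor P M hMK,
    ← Matrix.mulVec_mulVec, deriv_mulVec, hepsN]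

/-! ## §2 (1.10) clause 2, sup-norm operator form, King's spelling -/

/-- **[Ba 4] (1.10) CLAUSE 2 ∕ King's Theorem 3.3 (3.7) WITH THE DERIVATIVE, OPERATOR FORM, mass-uniform**: `∃ c₀ > 0` (function of
`d, L, a, m₀²`) such that for EVERY `0 ≤ m² ≤ m₀²`, every volume `(d, L, m, K)` with `K ≥ 1`, any spelling `N = L^K`, every `f` on the fine
torus with `|f| ≤ F`, every fine point `x` and direction `μ`:
`|N·(((fineOp N M a_K N² m²)⁻¹ f)(x + e_μ) − ((fineOp N M a_K N² m²)⁻¹ f)(x))| ≤ c₀·F` — the sup-norm bound of the forward η-derivative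
`∂^η_μ A₀⁻¹f` (`η⁻¹ = N`), uniform in the number of levels (`thm110_zero_torus_unif` clause 2 at `D = 0`, read through §1).
[cite: Balaban1983RegularityDecay, Theorem (1.10) p.573; King1986, Theorem 3.3 (3.7) p.658] -/
theorem fineOp_inv_deriv_mulVec_le_unif (dd L : ℕ) (hd : 1 ≤ dd) (hL : Odd L ∧ 1 < L) {a : ℝ} (ha : 0 < a) {m0sq : ℝ}
    (hm0 : 0 ≤ m0sq) :
    ∃ c₀ : ℝ, 0 < c₀ ∧ ∀ (P : Params), P.d = dd → P.L = L → 1 ≤ P.K →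
      ∀ (msq : ℝ), 0 ≤ msq → msq ≤ m0sq →
      ∀ (M : Fin P.d → ℕ) [∀ μ, NeZero (M μ)] (_hMK : ∀ μ, M μ = P.sitesPerDir P.K)
        (N : ℕ) [NeZero N] (_hN : N = P.L ^ P.K) (f : Tor (fine N M) → ℝ) (F : ℝ), (∀ y, |f y| ≤ F) →
        ∀ (xt : Tor (fine N M)) (μ : Fin P.d),
        |(N : ℝ) * (((fineOp N M (aK a P.L P.K) (((N : ℕ) : ℝ) ^ 2) msq)⁻¹ *ᵥ f) (xt + unitVec (fine N M) μ)
            - ((fineOp N M (aK a P.L P.K) (((N : ℕ) : ℝ) ^ 2) msq)⁻¹ *ᵥ f) xt)| ≤ c₀ * F := by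
  obtain ⟨δ₀, c₀, hδ₀, hc₀, H⟩ :=
    Balaban1983to89.B4Thm110ZeroTorus.thm110_zero_torus_unif dd L hd hL ha hm0
  refine ⟨c₀, hc₀, ?_⟩
  intro P hPd hPL hK msq hmsq hcap M _ hMK N _ hN f F hF xt μ
  subst hN
  set x : Balaban1983to89.Site P 0 := (torEquiv P M hMK).symm xt with hxdef
  have hxt : toTor P M hMK x = xt := (torEquiv P M hMK).apply_symm_apply xt
  -- the source on the tower's fine lattice
  set g : Balaban1983to89.Site P 0 → ℝ := fun z => f (toTor P M hMK z) with hgdef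
  have hgF : ∀ z, |g z| ≤ F := fun z => hF _
  have hmain := (H P hPd hPL msq hmsq hcap P.K hK le_rfl x g F 0 hgF le_rfl
    (fun z _ => Balaban1983to89.B5Ineq137Torus.T_nonneg P 0 x z)).2 μ
  rw [mul_zero, mul_zero, neg_zero, Real.exp_zero, mul_one] at hmain
  rw [← hxt, fineOp_inv_deriv_mulVec_toTor P M hMK]
  exact hmain

/-- **The same WITH THE PRINTED DECAY FROM THE SUPPORT, in block-distance currency**: `∃ δ₀ c₀ > 0` such that for EVERY `0 ≤ m² ≤ m₀²`,
every volume, any spelling `N = L^K`, every `f` with `|f| ≤ F` vanishing on the fine points whose unit block is within torus distance `< D` of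
the block of `x`, every direction `μ`:  `|N·(((fineOp N M a_K N² m²)⁻¹ f)(x + e_μ) − ((fineOp N M a_K N² m²)⁻¹ f)(x))| ≤ c₀·e^{−δ₀D}·F` —
[Ba 4] (1.10) clause 2 `c₀exp(−δ₀ dist(x, supp f))‖f‖_∞` with `dist` read on the unit blocks (`T_blk_le_eps_mul`: the block distance is at
most the physical distance `+ 2`, the slack `e^{2δ₀}` is in `c₀`). [cite: Balaban1983RegularityDecay, Theorem (1.10) p.573; King1986, Theorem 3.3 (3.7) p.658] -/
theorem fineOp_inv_deriv_mulVec_decay_unif (dd L : ℕ) (hd : 1 ≤ dd) (hL : Odd L ∧ 1 < L) {a : ℝ} (ha : 0 < a) {m0sq : ℝ}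
    (hm0 : 0 ≤ m0sq) :
    ∃ δ₀ c₀ : ℝ, 0 < δ₀ ∧ 0 < c₀ ∧ ∀ (P : Params), P.d = dd → P.L = L → 1 ≤ P.K →
      ∀ (msq : ℝ), 0 ≤ msq → msq ≤ m0sq →
      ∀ (M : Fin P.d → ℕ) [∀ μ, NeZero (M μ)] (_hMK : ∀ μ, M μ = P.sitesPerDir P.K)
        (N : ℕ) [NeZero N] (_hN : N = P.L ^ P.K) (f : Tor (fine N M) → ℝ) (F D : ℝ), (∀ y, |f y| ≤ F) →
        ∀ xt : Tor (fine N M), (∀ yt, f yt ≠ 0 → D ≤ tdistT M (blockOf N M xt) (blockOf N M yt)) →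
        ∀ μ : Fin P.d,
        |(N : ℝ) * (((fineOp N M (aK a P.L P.K) (((N : ℕ) : ℝ) ^ 2) msq)⁻¹ *ᵥ f) (xt + unitVec (fine N M) μ)
            - ((fineOp N M (aK a P.L P.K) (((N : ℕ) : ℝ) ^ 2) msq)⁻¹ *ᵥ f) xt)|
          ≤ c₀ * Real.exp (-(δ₀ * D)) * F := by
  obtain ⟨δ₀, c₀, hδ₀, hc₀, H⟩ :=
    Balaban1983to89.B4Thm110ZeroTorus.thm110_zero_torus_unif dd L hd hL ha hm0
  refine ⟨δ₀, c₀ * Real.exp (2 * δ₀), hδ₀, by positivity, ?_⟩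
  intro P hPd hPL hK msq hmsq hcap M _ hMK N _ hN f F D hF xt hsupp μ
  subst hN
  set x : Balaban1983to89.Site P 0 := (torEquiv P M hMK).symm xt with hxdef
  have hxt : toTor P M hMK x = xt := (torEquiv P M hMK).apply_symm_apply xt
  have hε : 0 < P.eps := Params.eps_pos P
  -- the source on the tower's fine lattice and the fine distance fed to (1.10)
  set g : Balaban1983to89.Site P 0 → ℝ := fun z => f (toTor P M hMK z) with hgdef
  have hgF : ∀ z, |g z| ≤ F := fun z => hF _
  set D' : ℝ := max 0 ((D - 2) / P.eps) with hD'def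
  have hD'0 : 0 ≤ D' := le_max_left _ _
  have hD'le : ∀ z : Balaban1983to89.Site P 0, g z ≠ 0 → D' ≤ T P 0 x z := by
    intro z hz
    rcases le_total ((D - 2) / P.eps) 0 with h | h
    · rw [hD'def, max_eq_left h]
      exact Balaban1983to89.B5Ineq137Torus.T_nonneg P 0 x z
    · rw [hD'def, max_eq_right h, div_le_iff₀ hε]
      have hdom := T_blk_le_eps_mul P x z
      have hDz := hsupp (toTor P M hMK z) hz
      rw [← hxt, blockOf_toTor P M hMK z, tdistT_blockOf_toTor, ← blk_eq_proj] at hDz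
      linarith [mul_comm P.eps (T P 0 x z)]
  have hεD : D - 2 ≤ P.eps * D' := by
    have h1 : P.eps * ((D - 2) / P.eps) ≤ P.eps * D' := mul_le_mul_of_nonneg_left (le_max_right _ _) hε.le
    rwa [mul_div_cancel₀ _ hε.ne'] at h1
  have hmain := (H P hPd hPL msq hmsq hcap P.K hK le_rfl x g F D' hgF hD'0 hD'le).2 μ
  have hF0 : 0 ≤ F := (abs_nonneg _).trans (hF xt)
  have hexp : Real.exp (-(δ₀ * (P.eps * D'))) ≤ Real.exp (2 * δ₀) * Real.exp (-(δ₀ * D)) := by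
    rw [← Real.exp_add]
    apply Real.exp_le_exp.mpr
    nlinarith [mul_le_mul_of_nonneg_left hεD hδ₀.le]
  rw [← hxt, fineOp_inv_deriv_mulVec_toTor P M hMK]
  calc |((deriv P 0 P.eps μ * (tower P a msq).G P.K) *ᵥ g) x| ≤ c₀ * Real.exp (-(δ₀ * (P.eps * D'))) * F := hmain
    _ ≤ c₀ * (Real.exp (2 * δ₀) * Real.exp (-(δ₀ * D))) * F :=
        mul_le_mul_of_nonneg_right (mul_le_mul_of_nonneg_left hexp hc₀.le) hF0
    _ = c₀ * Real.exp (2 * δ₀) * Real.exp (-(δ₀ * D)) * F := by ring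

end Torus

end Literature.MathematicalPhysics.QuantumFieldTheory.King1986
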